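import Literature.ModelTheory.ExponentialFields.SemialgebraicC1BoundaryExtension
import HarnessLib

/-!
# Pinched fibrewise-affine interpolation is `C¹` (Pawłucki's Lemma 5.2 for `p = 1`)

Topic `Literature/ModelTheory/ExponentialFields` — block B6 of the proof of the
`C¹`-triangulation theorem for compact semialgebraic sets
(`Literature.ModelTheory.ExponentialFields.OhmotoShiota2017_c1Triangulation`, statement of
[OhmotoShiota2017, Thm. 1.1]) along the proof of [Pawlucki2024], specialized to `p = 1`.

[Pawlucki2024, Lemma 5.2] (`p = 1`), in analytic form: over a base set `K`, the fibrewise affine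
map `Ψ(u, ξ) = β_lo(u) + θ(u, ξ) (β_hi - β_lo)(u)`, `θ = (ξ - λ_lo)/(λ_hi - λ_lo)`, from the prism
`[λ_lo, λ_hi]` onto `[β_lo, β_hi]` is `C¹` on the CLOSED prism — including the pinched part
`Z = {λ_lo = λ_hi}` — provided `β_hi - β_lo` is `1`-flat on `Z` and `λ_hi - λ_lo` dominates the
distance to `Z` along segments inside `K` (as for affine heights on a simplex pinched along a
face, [Pawlucki2024, proof of Lemma 5.2]). `C¹` on the closed prism is expressed as a derivative
field within the prism, continuous on the prism.

No named facts are introduced (D-0026).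

## References

* [Pawlucki2024] W. Pawłucki, *Strict `C^p`-triangulations — a new approach to
  desingularization*, J. Eur. Math. Soc. 26 (2024), 3863–3909, Lemma 5.2.
-/

noncomputable section

open Set Filter Metric
open _root_.Topology

namespace Literature.ModelTheory.ExponentialFields

section Pinch

variable {m : ℕ}

/-- The interpolation parameter `θ = (ξ - λ_lo(u)) / (λ_hi(u) - λ_lo(u))` (`0` on the pinched part).
[cite: Pawlucki2024, Lemma 5.2] -/
def pTheta (lo hi : (Fin m → ℝ) → ℝ) (p : Fin (m + 1) → ℝ) : ℝ :=
  if lo (Fin.init p) < hi (Fin.init p) then (p (Fin.last m) - lo (Fin.init p)) / (hi (Fin.init p) - lo (Fin.init p)) else 0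

/-- The fibre component of Pawłucki's interpolation map `Ψ`. [cite: Pawlucki2024, Lemma 5.2] -/
def pinchMap (lo hi βlo βhi : (Fin m → ℝ) → ℝ) (p : Fin (m + 1) → ℝ) : ℝ :=
  βlo (Fin.init p) + pTheta lo hi p * (βhi (Fin.init p) - βlo (Fin.init p))

/-- The closed prism `[λ_lo, λ_hi]` over `K`. [cite: Pawlucki2024, Lemma 5.2] -/
def prism (K : Set (Fin m → ℝ)) (lo hi : (Fin m → ℝ) → ℝ) : Set (Fin (m + 1) → ℝ) :=
  {p | Fin.init p ∈ K ∧ lo (Fin.init p) ≤ p (Fin.last m) ∧ p (Fin.last m) ≤ hi (Fin.init p)}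

/-- `θ ∈ [0, 1]` on the prism. [cite: Pawlucki2024, Lemma 5.2] -/
theorem pTheta_mem_Icc {K : Set (Fin m → ℝ)} {lo hi : (Fin m → ℝ) → ℝ} {p : Fin (m + 1) → ℝ} (hp : p ∈ prism K lo hi) :
    pTheta lo hi p ∈ Icc (0 : ℝ) 1 := by
  unfold pTheta
  split_ifs with h
  · have hden : 0 < hi (Fin.init p) - lo (Fin.init p) := sub_pos.2 h
    exact ⟨div_nonneg (sub_nonneg.2 hp.2.1) hden.le, (div_le_one hden).2 (by linarith [hp.2.2])⟩
  · exact ⟨le_rfl, zero_le_one⟩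

/-- `|θ| ≤ 1` on the prism. [cite: Pawlucki2024, Lemma 5.2] -/
theorem abs_pTheta_le {K : Set (Fin m → ℝ)} {lo hi : (Fin m → ℝ) → ℝ} {p : Fin (m + 1) → ℝ} (hp : p ∈ prism K lo hi) :
    |pTheta lo hi p| ≤ 1 := by
  have h := pTheta_mem_Icc hp
  rw [abs_of_nonneg h.1]; exact h.2

/-- On the bottom `Ψ = β_lo`. [cite: Pawlucki2024, Lemma 5.2] -/
theorem pinchMap_bottom {lo hi βlo βhi : (Fin m → ℝ) → ℝ} (u : Fin m → ℝ) :
    pinchMap lo hi βlo βhi (Fin.snoc u (lo u)) = βlo u := by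
  simp only [pinchMap, pTheta, Fin.init_snoc, Fin.snoc_last, sub_self, zero_div]
  split_ifs <;> simp

/-- On the top `Ψ = β_hi` (where the prism is not pinched). [cite: Pawlucki2024, Lemma 5.2] -/
theorem pinchMap_top {lo hi βlo βhi : (Fin m → ℝ) → ℝ} {u : Fin m → ℝ} (h : lo u < hi u) :
    pinchMap lo hi βlo βhi (Fin.snoc u (hi u)) = βhi u := by
  simp only [pinchMap, pTheta, Fin.init_snoc, Fin.snoc_last, if_pos h]
  rw [div_self (sub_ne_zero.2 h.ne')]; ring

/-- `‖init v‖ ≤ ‖v‖`. [folklore] -/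
theorem norm_init_le (v : Fin (m + 1) → ℝ) : ‖Fin.init v‖ ≤ ‖v‖ := by
  refine (pi_norm_le_iff_of_nonneg (norm_nonneg v)).2 fun i => ?_
  exact norm_le_pi_norm v i.castSucc

/-- `‖initL‖ ≤ 1`. [folklore] -/
theorem norm_initL_le : ‖initL m‖ ≤ 1 :=
  ContinuousLinearMap.opNorm_le_bound _ zero_le_one fun v => by rw [one_mul, initL_apply]; exact norm_init_le v

/-- `‖projL‖ ≤ 1`. [folklore] -/
theorem norm_projL_le : ‖projL m‖ ≤ 1 :=
  ContinuousLinearMap.opNorm_le_bound _ zero_le_one fun v => by rw [one_mul, projL_apply]; exact norm_le_pi_norm v _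

/-- Composition with `init`: derivative. [folklore] -/
theorem hasFDerivAt_comp_init {g : (Fin m → ℝ) → ℝ} {g' : (Fin m → ℝ) →L[ℝ] ℝ} {p : Fin (m + 1) → ℝ}
    (hg : HasFDerivAt g g' (Fin.init p)) : HasFDerivAt (fun q : Fin (m + 1) → ℝ => g (Fin.init q)) (g'.comp (initL m)) p := by
  have hi : HasFDerivAt (fun q : Fin (m + 1) → ℝ => (Fin.init q : Fin m → ℝ)) (initL m) p := (initL m).hasFDerivAt
  exact hg.comp p hi

/-- **Lemma 5.2 for `p = 1` (analytic form).** Let `λ_lo ≤ λ_hi` and `β_lo, β_hi` be `C¹` on an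
open `V ⊇ K`, with `λ_lo = λ_hi` exactly on `Z ⊆ K`; assume `β_hi - β_lo` vanishes together with
its derivative on `Z` ("`1`-flat on the pinched face"), the derivatives of `λ_lo, λ_hi` are bounded
on `K`, and every `u ∈ K` is joined inside `K` to a point `π(u) ∈ Z` with
`‖u - π(u)‖ ≤ C (λ_hi - λ_lo)(u)` (as for affine heights on a simplex pinched along a face). Then
the interpolation map `Ψ` has a derivative field within the closed prism `[λ_lo, λ_hi]` which is
continuous on the prism. [cite: Pawlucki2024, Lemma 5.2] -/
theorem pinchMap_hasFDerivWithinAt {K Z V : Set (Fin m → ℝ)} (hV : IsOpen V) (hKV : K ⊆ V) (hZK : Z ⊆ K)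
    {lo hi βlo βhi : (Fin m → ℝ) → ℝ} (hloC : ContDiffOn ℝ 1 lo V) (hhiC : ContDiffOn ℝ 1 hi V)
    (hβloC : ContDiffOn ℝ 1 βlo V) (hβhiC : ContDiffOn ℝ 1 βhi V)
    (hle : ∀ u ∈ K, lo u ≤ hi u) (hZ : ∀ u ∈ K, lo u = hi u ↔ u ∈ Z)
    (hd0 : ∀ u ∈ Z, βhi u = βlo u) (hdD : ∀ u ∈ Z, fderiv ℝ βhi u = fderiv ℝ βlo u)
    {Clam : ℝ} (hDlam : ∀ u ∈ K, ‖fderiv ℝ lo u‖ ≤ Clam ∧ ‖fderiv ℝ hi u‖ ≤ Clam)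
    (π : (Fin m → ℝ) → (Fin m → ℝ)) (hπZ : ∀ u ∈ K, π u ∈ Z) (hseg : ∀ u ∈ K, segment ℝ (π u) u ⊆ K)
    {C : ℝ} (hπbd : ∀ u ∈ K, ‖u - π u‖ ≤ C * (hi u - lo u)) :
    ∃ L : (Fin (m + 1) → ℝ) → (Fin (m + 1) → ℝ) →L[ℝ] ℝ, ContinuousOn L (prism K lo hi) ∧
      ∀ p ∈ prism K lo hi, HasFDerivWithinAt (pinchMap lo hi βlo βhi) (L p) (prism K lo hi) p := by
  classical
  -- the smooth formula off the pinched part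
  set O : Set (Fin (m + 1) → ℝ) := {p | Fin.init p ∈ V ∧ lo (Fin.init p) < hi (Fin.init p)} with hO
  have hci : Continuous fun p : Fin (m + 1) → ℝ => (Fin.init p : Fin m → ℝ) := continuous_pi fun i => continuous_apply _
  have hOo : IsOpen O := by
    have h1 : IsOpen {p : Fin (m + 1) → ℝ | (Fin.init p : Fin m → ℝ) ∈ V} := hV.preimage hci
    have hc : ContinuousOn (fun p : Fin (m + 1) → ℝ => hi (Fin.init p) - lo (Fin.init p)) {p : Fin (m + 1) → ℝ | (Fin.init p : Fin m → ℝ) ∈ V} :=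
      (hhiC.continuousOn.comp hci.continuousOn fun p hp => hp).sub (hloC.continuousOn.comp hci.continuousOn fun p hp => hp)
    have h2 := hc.isOpen_inter_preimage h1 (isOpen_Ioi (a := (0 : ℝ)))
    have heq : O = {p : Fin (m + 1) → ℝ | (Fin.init p : Fin m → ℝ) ∈ V} ∩ (fun p : Fin (m + 1) → ℝ => hi (Fin.init p) - lo (Fin.init p)) ⁻¹' Ioi 0 := by
      ext p; simp only [hO, mem_setOf_eq, mem_inter_iff, mem_preimage, mem_Ioi, sub_pos]
    rw [heq]; exact h2
  set d : (Fin m → ℝ) → ℝ := fun u => βhi u - βlo u with hddef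
  set F : (Fin (m + 1) → ℝ) → ℝ := fun p => βlo (Fin.init p) +
    (p (Fin.last m) - lo (Fin.init p)) / (hi (Fin.init p) - lo (Fin.init p)) * d (Fin.init p) with hF
  have hFeq : ∀ p ∈ O, pinchMap lo hi βlo βhi p = F p := by
    intro p hp; simp only [pinchMap, pTheta, if_pos hp.2, hF, hddef]
  have hinitC : ContDiff ℝ 1 fun p : Fin (m + 1) → ℝ => (Fin.init p : Fin m → ℝ) := (initL m).contDiff
  have hFC1 : ContDiffOn ℝ 1 F O := by
    have hV' : ∀ {g : (Fin m → ℝ) → ℝ}, ContDiffOn ℝ 1 g V → ContDiffOn ℝ 1 (fun p : Fin (m + 1) → ℝ => g (Fin.init p)) O :=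
      fun hg => hg.comp hinitC.contDiffOn fun p hp => hp.1
    refine (hV' hβloC).add (ContDiffOn.mul (ContDiffOn.div ?_ ?_ fun p hp => sub_ne_zero.2 hp.2.ne') ((hV' hβhiC).sub (hV' hβloC)))
    · exact (contDiff_apply ℝ ℝ (Fin.last m)).contDiffOn.sub (hV' hloC)
    · exact (hV' hhiC).sub (hV' hloC)
  -- the derivative field
  set L : (Fin (m + 1) → ℝ) → (Fin (m + 1) → ℝ) →L[ℝ] ℝ := fun p =>
    if lo (Fin.init p) < hi (Fin.init p) then fderiv ℝ F p else (fderiv ℝ βlo (Fin.init p)).comp (initL m) with hL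
  -- differentiability of the data at points of `K`
  have hdiff : ∀ {g : (Fin m → ℝ) → ℝ}, ContDiffOn ℝ 1 g V → ∀ u ∈ K, HasFDerivAt g (fderiv ℝ g u) u := fun hg u hu =>
    ((hg.differentiableOn one_ne_zero u (hKV hu)).differentiableAt (hV.mem_nhds (hKV hu))).hasFDerivAt
  have hdC : ContDiffOn ℝ 1 d V := hβhiC.sub hβloC
  have hd_fderiv : ∀ u ∈ K, fderiv ℝ d u = fderiv ℝ βhi u - fderiv ℝ βlo u := fun u hu =>
    ((hdiff hβhiC u hu).sub (hdiff hβloC u hu)).fderiv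
  have hdZ0 : ∀ u ∈ Z, d u = 0 := fun u hu => by simp only [hddef, hd0 u hu, sub_self]
  have hdZD : ∀ u ∈ Z, fderiv ℝ d u = 0 := fun u hu => by rw [hd_fderiv u (hZK hu), hdD u hu, sub_self]
  -- the derivative bound off the pinched part
  set Cl : ℝ := max Clam 0 with hCl
  have hCl0 : 0 ≤ Cl := le_max_right _ _
  have hDlam' : ∀ u ∈ K, ‖fderiv ℝ lo u‖ ≤ Cl ∧ ‖fderiv ℝ hi u‖ ≤ Cl := fun u hu =>
    ⟨(hDlam u hu).1.trans (le_max_left _ _), (hDlam u hu).2.trans (le_max_left _ _)⟩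
  have hbound : ∀ q ∈ prism K lo hi, lo (Fin.init q) < hi (Fin.init q) →
      ‖fderiv ℝ F q - (fderiv ℝ βlo (Fin.init q)).comp (initL m)‖ ≤
        ‖fderiv ℝ d (Fin.init q)‖ + |d (Fin.init q)| * ((1 + 3 * Cl) / (hi (Fin.init q) - lo (Fin.init q))) := by
    intro q hq hlt
    obtain ⟨huK, hlo, hhi⟩ := hq
    set u' := Fin.init q with hu'
    have hDn : 0 < hi u' - lo u' := sub_pos.2 hlt
    -- the pieces and their derivatives
    have hA : HasFDerivAt (fun q : Fin (m + 1) → ℝ => βlo (Fin.init q)) ((fderiv ℝ βlo u').comp (initL m)) q :=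
      hasFDerivAt_comp_init (hdiff hβloC u' huK)
    have hN : HasFDerivAt (fun q : Fin (m + 1) → ℝ => q (Fin.last m) - lo (Fin.init q)) (projL m - (fderiv ℝ lo u').comp (initL m)) q :=
      ((projL m).hasFDerivAt).sub (hasFDerivAt_comp_init (hdiff hloC u' huK))
    have hD : HasFDerivAt (fun q : Fin (m + 1) → ℝ => hi (Fin.init q) - lo (Fin.init q)) ((fderiv ℝ hi u' - fderiv ℝ lo u').comp (initL m)) q := by
      have h := (hasFDerivAt_comp_init (hdiff hhiC u' huK)).sub (hasFDerivAt_comp_init (hdiff hloC u' huK) (p := q))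
      refine h.congr_fderiv ?_
      rw [ContinuousLinearMap.sub_comp]
    have hInv : HasFDerivAt (fun q : Fin (m + 1) → ℝ => (hi (Fin.init q) - lo (Fin.init q))⁻¹)
        ((-((hi u' - lo u') ^ 2)⁻¹) • (fderiv ℝ hi u' - fderiv ℝ lo u').comp (initL m)) q :=
      (hasDerivAt_inv hDn.ne').comp_hasFDerivAt q hD
    have hDf : HasFDerivAt (fun q : Fin (m + 1) → ℝ => d (Fin.init q)) ((fderiv ℝ d u').comp (initL m)) q :=
      hasFDerivAt_comp_init (hdiff hdC u' huK)
    -- `θ = N * Dn⁻¹` and `F = A + θ * Df`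
    set N' := projL m - (fderiv ℝ lo u').comp (initL m) with hN'
    set Dn' := (fderiv ℝ hi u' - fderiv ℝ lo u').comp (initL m) with hDn'
    set Θ' : (Fin (m + 1) → ℝ) →L[ℝ] ℝ := (q (Fin.last m) - lo u') • ((-((hi u' - lo u') ^ 2)⁻¹) • Dn') + (hi u' - lo u')⁻¹ • N' with hΘ'
    have hΘ : HasFDerivAt (fun q : Fin (m + 1) → ℝ => (q (Fin.last m) - lo (Fin.init q)) * (hi (Fin.init q) - lo (Fin.init q))⁻¹) Θ' q := by
      have h := hN.mul hInv
      exact h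
    set θq := (q (Fin.last m) - lo u') * (hi u' - lo u')⁻¹ with hθq
    set F' : (Fin (m + 1) → ℝ) →L[ℝ] ℝ := (fderiv ℝ βlo u').comp (initL m) + (θq • (fderiv ℝ d u').comp (initL m) + d u' • Θ') with hF'
    have hFd : HasFDerivAt F F' q := by
      have h := hA.add (hΘ.mul hDf)
      have heq : F = fun q : Fin (m + 1) → ℝ => βlo (Fin.init q) +
          (q (Fin.last m) - lo (Fin.init q)) * (hi (Fin.init q) - lo (Fin.init q))⁻¹ * d (Fin.init q) := by
        funext q'; simp only [hF, div_eq_mul_inv]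
      rw [heq]
      exact h
    rw [hFd.fderiv]
    have hdiffF : F' - (fderiv ℝ βlo u').comp (initL m) = θq • (fderiv ℝ d u').comp (initL m) + d u' • Θ' := by
      rw [hF']; abel
    rw [hdiffF]
    -- norms
    have hθ1 : |θq| ≤ 1 := by
      rw [hθq, ← div_eq_mul_inv, abs_div, abs_of_pos hDn, div_le_one hDn, abs_le]
      constructor <;> linarith
    have hN'n : ‖N'‖ ≤ 1 + Cl := by
      calc ‖N'‖ ≤ ‖projL m‖ + ‖(fderiv ℝ lo u').comp (initL m)‖ := norm_sub_le _ _
        _ ≤ 1 + ‖fderiv ℝ lo u'‖ * ‖initL m‖ := add_le_add norm_projL_le (ContinuousLinearMap.opNorm_comp_le _ _)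
        _ ≤ 1 + Cl * 1 := by
            refine add_le_add le_rfl (mul_le_mul (hDlam' u' huK).1 norm_initL_le (norm_nonneg _) hCl0)
        _ = 1 + Cl := by ring
    have hDn'n : ‖Dn'‖ ≤ 2 * Cl := by
      calc ‖Dn'‖ ≤ ‖fderiv ℝ hi u' - fderiv ℝ lo u'‖ * ‖initL m‖ := ContinuousLinearMap.opNorm_comp_le _ _
        _ ≤ (Cl + Cl) * 1 := mul_le_mul ((norm_sub_le _ _).trans (add_le_add (hDlam' u' huK).2 (hDlam' u' huK).1)) norm_initL_le (norm_nonneg _) (by positivity)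
        _ = 2 * Cl := by ring
    have hNq : |q (Fin.last m) - lo u'| ≤ hi u' - lo u' := by
      rw [abs_le]; constructor <;> linarith
    have hΘ'n : ‖Θ'‖ ≤ (1 + 3 * Cl) / (hi u' - lo u') := by
      have h1 : ‖(q (Fin.last m) - lo u') • ((-((hi u' - lo u') ^ 2)⁻¹) • Dn')‖ ≤ (hi u' - lo u')⁻¹ * (2 * Cl) := by
        rw [norm_smul, norm_smul, Real.norm_eq_abs, Real.norm_eq_abs, abs_neg, abs_inv, abs_of_pos (pow_pos hDn 2)]
        calc |q (Fin.last m) - lo u'| * (((hi u' - lo u') ^ 2)⁻¹ * ‖Dn'‖)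
            ≤ (hi u' - lo u') * (((hi u' - lo u') ^ 2)⁻¹ * (2 * Cl)) :=
              mul_le_mul hNq (mul_le_mul_of_nonneg_left hDn'n (by positivity)) (by positivity) hDn.le
          _ = (hi u' - lo u')⁻¹ * (2 * Cl) := by field_simp
      have h2 : ‖(hi u' - lo u')⁻¹ • N'‖ ≤ (hi u' - lo u')⁻¹ * (1 + Cl) := by
        rw [norm_smul, Real.norm_eq_abs, abs_inv, abs_of_pos hDn]
        exact mul_le_mul_of_nonneg_left hN'n (by positivity)
      calc ‖Θ'‖ ≤ ‖(q (Fin.last m) - lo u') • ((-((hi u' - lo u') ^ 2)⁻¹) • Dn')‖ + ‖(hi u' - lo u')⁻¹ • N'‖ := norm_add_le _ _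
        _ ≤ (hi u' - lo u')⁻¹ * (2 * Cl) + (hi u' - lo u')⁻¹ * (1 + Cl) := add_le_add h1 h2
        _ = (1 + 3 * Cl) / (hi u' - lo u') := by rw [div_eq_inv_mul]; ring
    calc ‖θq • (fderiv ℝ d u').comp (initL m) + d u' • Θ'‖
        ≤ ‖θq • (fderiv ℝ d u').comp (initL m)‖ + ‖d u' • Θ'‖ := norm_add_le _ _
      _ ≤ 1 * ‖fderiv ℝ d u'‖ + |d u'| * ((1 + 3 * Cl) / (hi u' - lo u')) := by
          refine add_le_add ?_ ?_
          · rw [norm_smul, Real.norm_eq_abs]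
            refine mul_le_mul hθ1 ?_ (norm_nonneg _) zero_le_one
            calc ‖(fderiv ℝ d u').comp (initL m)‖ ≤ ‖fderiv ℝ d u'‖ * ‖initL m‖ := ContinuousLinearMap.opNorm_comp_le _ _
              _ ≤ ‖fderiv ℝ d u'‖ * 1 := mul_le_mul_of_nonneg_left norm_initL_le (norm_nonneg _)
              _ = ‖fderiv ℝ d u'‖ := mul_one _
          · rw [norm_smul, Real.norm_eq_abs]
            exact mul_le_mul_of_nonneg_left hΘ'n (abs_nonneg _)
      _ = ‖fderiv ℝ d u'‖ + |d u'| * ((1 + 3 * Cl) / (hi u' - lo u')) := by rw [one_mul]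
  refine ⟨L, fun p₀ hp₀ => ?_, fun p hp => ?_⟩
  · -- continuity of the field
    obtain ⟨hu₀K, hlo₀, hhi₀⟩ := hp₀
    set u₀ := Fin.init p₀ with hu₀
    by_cases hlt₀ : lo u₀ < hi u₀
    · have hp₀O : p₀ ∈ O := ⟨hKV hu₀K, hlt₀⟩
      have hc : ContinuousAt (fun q => fderiv ℝ F q) p₀ := (hFC1.continuousOn_fderiv_of_isOpen hOo le_rfl).continuousAt (hOo.mem_nhds hp₀O)
      have heq : L =ᶠ[𝓝 p₀] fun q => fderiv ℝ F q := by
        filter_upwards [hOo.mem_nhds hp₀O] with q hq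
        simp only [hL, if_pos hq.2]
      have hLp : L p₀ = fderiv ℝ F p₀ := by simp only [hL]; rw [← hu₀]; exact if_pos hlt₀
      have hLc : ContinuousAt L p₀ := by
        rw [ContinuousAt, hLp]; exact hc.tendsto.congr' (heq.mono fun q hq => hq.symm)
      exact hLc.continuousWithinAt
    · have heq₀ : lo u₀ = hi u₀ := le_antisymm (hle u₀ hu₀K) (not_lt.1 hlt₀)
      have hu₀Z : u₀ ∈ Z := (hZ u₀ hu₀K).1 heq₀
      have hLp : L p₀ = (fderiv ℝ βlo u₀).comp (initL m) := by simp only [hL]; rw [← hu₀]; exact if_neg hlt₀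
      rw [ContinuousWithinAt, hLp, Metric.tendsto_nhdsWithin_nhds]
      intro ε hε
      -- continuity of the data at `u₀`
      have hcβ : ContinuousAt (fun u => fderiv ℝ βlo u) u₀ := (hβloC.continuousOn_fderiv_of_isOpen hV le_rfl).continuousAt (hV.mem_nhds (hKV hu₀K))
      have hcd : ContinuousAt (fun u => fderiv ℝ d u) u₀ := (hdC.continuousOn_fderiv_of_isOpen hV le_rfl).continuousAt (hV.mem_nhds (hKV hu₀K))
      have hcD : ContinuousAt (fun u => hi u - lo u) u₀ :=
        ((hhiC.continuousOn.continuousAt (hV.mem_nhds (hKV hu₀K))).sub (hloC.continuousOn.continuousAt (hV.mem_nhds (hKV hu₀K))))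
      set A : ℝ := 1 + |C| * ((1 + 3 * Cl)) with hA
      have hApos : 0 < A := by rw [hA]; positivity
      set η : ℝ := ε / (2 * A) with hη
      have hηpos : 0 < η := div_pos hε (by positivity)
      obtain ⟨ρ, hρ, hρV, hρβ, hρd⟩ : ∃ ρ > 0, ball u₀ ρ ⊆ V ∧ (∀ u ∈ ball u₀ ρ, ‖fderiv ℝ βlo u - fderiv ℝ βlo u₀‖ < ε / 2) ∧
          ∀ u ∈ ball u₀ ρ, ‖fderiv ℝ d u‖ ≤ η := by
        have h1 : ∀ᶠ u in 𝓝 u₀, dist (fderiv ℝ βlo u) (fderiv ℝ βlo u₀) < ε / 2 := Metric.tendsto_nhds.1 hcβ.tendsto _ (half_pos hε)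
        have h2 : ∀ᶠ u in 𝓝 u₀, dist (fderiv ℝ d u) (fderiv ℝ d u₀) < η := Metric.tendsto_nhds.1 hcd.tendsto _ hηpos
        obtain ⟨ρ, hρ, hb⟩ := Metric.eventually_nhds_iff.1 ((h1.and h2).and (hV.mem_nhds (hKV hu₀K)))
        refine ⟨ρ, hρ, fun u hu => (hb hu).2, fun u hu => by have := (hb hu).1.1; rwa [dist_eq_norm] at this, fun u hu => ?_⟩
        have h := (hb (mem_ball.1 hu)).1.2
        rw [hdZD u₀ hu₀Z, dist_eq_norm, sub_zero] at h
        exact h.le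
      -- `hi - lo` small near `u₀` so that segments stay in the ball
      obtain ⟨ρ', hρ', hρ'D⟩ : ∃ ρ' > 0, ∀ u ∈ ball u₀ ρ', |C| * (hi u - lo u) < ρ / 2 := by
        have h : Tendsto (fun u => |C| * (hi u - lo u)) (𝓝 u₀) (𝓝 (|C| * (hi u₀ - lo u₀))) := hcD.tendsto.const_mul _
        rw [← heq₀, sub_self, mul_zero] at h
        obtain ⟨ρ', hρ', hb⟩ := Metric.eventually_nhds_iff.1 (Metric.tendsto_nhds.1 h _ (half_pos hρ))
        refine ⟨ρ', hρ', fun u hu => ?_⟩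
        have := hb (mem_ball.1 hu); rw [Real.dist_eq, sub_zero] at this
        exact (le_abs_self _).trans_lt this
      refine ⟨min (ρ / 2) ρ', lt_min (half_pos hρ) hρ', fun q hq hdq => ?_⟩
      obtain ⟨huK, hlo, hhi⟩ := hq
      set u' := Fin.init q with hu'
      have hdu : dist u' u₀ < min (ρ / 2) ρ' := by
        have h : dist u' u₀ ≤ dist q p₀ := by
          rw [dist_eq_norm, dist_eq_norm]
          have : u' - u₀ = Fin.init (q - p₀) := by funext i; simp [hu', hu₀, Fin.init]
          rw [this]; exact norm_init_le _
        exact h.trans_lt hdq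
      have hu'ball : u' ∈ ball u₀ ρ := mem_ball.2 (hdu.trans_le ((min_le_left _ _).trans (half_le_self hρ.le)))
      have hβ' : ‖(fderiv ℝ βlo u').comp (initL m) - (fderiv ℝ βlo u₀).comp (initL m)‖ < ε / 2 := by
        rw [← ContinuousLinearMap.sub_comp]
        calc ‖(fderiv ℝ βlo u' - fderiv ℝ βlo u₀).comp (initL m)‖ ≤ ‖fderiv ℝ βlo u' - fderiv ℝ βlo u₀‖ * ‖initL m‖ := ContinuousLinearMap.opNorm_comp_le _ _
          _ ≤ ‖fderiv ℝ βlo u' - fderiv ℝ βlo u₀‖ * 1 := mul_le_mul_of_nonneg_left norm_initL_le (norm_nonneg _)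
          _ < ε / 2 := by rw [mul_one]; exact hρβ u' hu'ball
      rw [dist_eq_norm]
      by_cases hlt : lo u' < hi u'
      · have hLq : L q = fderiv ℝ F q := by simp only [hL]; rw [← hu']; exact if_pos hlt
        rw [hLq]
        -- the segment `[π u', u']` lies in `ball u₀ ρ`
        have hsegball : segment ℝ (π u') u' ⊆ ball u₀ ρ := by
          have hπu : ‖u' - π u'‖ < ρ / 2 := by
            calc ‖u' - π u'‖ ≤ C * (hi u' - lo u') := hπbd u' huK
              _ ≤ |C| * (hi u' - lo u') := mul_le_mul_of_nonneg_right (le_abs_self C) (sub_nonneg.2 (hle u' huK))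
              _ < ρ / 2 := hρ'D u' (mem_ball.2 (hdu.trans_le (min_le_right _ _)))
          have hconv : Convex ℝ (ball u₀ ρ) := convex_ball u₀ ρ
          refine hconv.segment_subset ?_ hu'ball
          rw [mem_ball, dist_eq_norm]
          calc ‖π u' - u₀‖ = ‖(π u' - u') + (u' - u₀)‖ := by rw [sub_add_sub_cancel]
            _ ≤ ‖π u' - u'‖ + ‖u' - u₀‖ := norm_add_le _ _
            _ < ρ / 2 + ρ / 2 := by
                refine add_lt_add (by rw [norm_sub_rev]; exact hπu) ?_
                rw [← dist_eq_norm]; exact hdu.trans_le ((min_le_left _ _))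
            _ = ρ := by ring
        -- mean value: `|d u'| ≤ η ‖u' - π u'‖`
        have hdMVT : |d u'| ≤ η * ‖u' - π u'‖ := by
          have hπ0 : d (π u') = 0 := hdZ0 _ (hπZ u' huK)
          have hder : ∀ w ∈ segment ℝ (π u') u', HasFDerivWithinAt d (fderiv ℝ d w) (segment ℝ (π u') u') w := fun w hw =>
            (hdiff hdC w (hseg u' huK hw)).hasFDerivWithinAt
          have h := (convex_segment (π u') u').norm_image_sub_le_of_norm_hasFDerivWithin_le hder
            (fun w hw => hρd w (hsegball hw)) (left_mem_segment ℝ _ _) (right_mem_segment ℝ _ _)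
          rw [hπ0, sub_zero, Real.norm_eq_abs] at h
          exact h
        have hb := hbound q ⟨huK, hlo, hhi⟩ hlt
        have hDn : 0 < hi u' - lo u' := sub_pos.2 hlt
        have hsecond : |d u'| * ((1 + 3 * Cl) / (hi u' - lo u')) ≤ η * (|C| * (1 + 3 * Cl)) := by
          calc |d u'| * ((1 + 3 * Cl) / (hi u' - lo u')) ≤ (η * (|C| * (hi u' - lo u'))) * ((1 + 3 * Cl) / (hi u' - lo u')) := by
                refine mul_le_mul_of_nonneg_right (hdMVT.trans (mul_le_mul_of_nonneg_left ?_ hηpos.le)) (by positivity)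
                exact (hπbd u' huK).trans (mul_le_mul_of_nonneg_right (le_abs_self C) hDn.le)
            _ = η * (|C| * (1 + 3 * Cl)) := by field_simp
        calc ‖fderiv ℝ F q - (fderiv ℝ βlo u₀).comp (initL m)‖
            ≤ ‖fderiv ℝ F q - (fderiv ℝ βlo u').comp (initL m)‖ + ‖(fderiv ℝ βlo u').comp (initL m) - (fderiv ℝ βlo u₀).comp (initL m)‖ := by
              rw [← sub_add_sub_cancel]; exact norm_add_le _ _
          _ < (η + η * (|C| * (1 + 3 * Cl))) + ε / 2 := by
              refine add_lt_add_of_le_of_lt (hb.trans (add_le_add (hρd u' hu'ball) hsecond)) hβ'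
          _ = η * A + ε / 2 := by rw [hA]; ring
          _ = ε := by rw [hη]; field_simp; ring
      · have hLq : L q = (fderiv ℝ βlo u').comp (initL m) := by simp only [hL]; rw [← hu']; exact if_neg hlt
        rw [hLq]
        exact hβ'.trans (half_lt_self hε)
  · -- differentiability within the prism
    obtain ⟨huK, hlo, hhi⟩ := hp
    set u := Fin.init p with hu
    by_cases hlt : lo u < hi u
    · have hpO : p ∈ O := ⟨hKV huK, hlt⟩
      have hLp : L p = fderiv ℝ F p := by simp only [hL]; rw [← hu]; exact if_pos hlt
      rw [hLp]
      have hFd : HasFDerivAt F (fderiv ℝ F p) p := ((hFC1.differentiableOn one_ne_zero p hpO).differentiableAt (hOo.mem_nhds hpO)).hasFDerivAt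
      have heq : pinchMap lo hi βlo βhi =ᶠ[𝓝 p] F := by
        filter_upwards [hOo.mem_nhds hpO] with q hq using hFeq q hq
      exact (hFd.congr_of_eventuallyEq heq).hasFDerivWithinAt
    · -- a pinched point: `u ∈ Z`, `p = (u, lo u)`
      have heq : lo u = hi u := le_antisymm (hle u huK) (not_lt.1 hlt)
      have huZ : u ∈ Z := (hZ u huK).1 heq
      have hplast : p (Fin.last m) = lo u := le_antisymm (by rw [heq]; exact hhi) hlo
      have hLp : L p = (fderiv ℝ βlo u).comp (initL m) := by simp only [hL]; rw [← hu]; exact if_neg hlt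
      rw [hLp, hasFDerivWithinAt_iff_isLittleO, Asymptotics.isLittleO_iff]
      intro ε hε
      -- `β_lo` is differentiable at `u`, `d` is differentiable at `u` with `d u = 0`, `Dd(u) = 0`
      have hβ := hdiff hβloC u huK
      have hdd : HasFDerivAt d (0 : (Fin m → ℝ) →L[ℝ] ℝ) u := by rw [← hdZD u huZ]; exact hdiff hdC u huK
      rw [hasFDerivAt_iff_isLittleO, Asymptotics.isLittleO_iff] at hβ hdd
      have h1 := hβ (half_pos hε)
      have h2 := hdd (half_pos hε)
      have hcont : Tendsto (fun q : Fin (m + 1) → ℝ => (Fin.init q : Fin m → ℝ)) (𝓝[prism K lo hi] p) (𝓝 u) :=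
        (hci.tendsto p).mono_left nhdsWithin_le_nhds
      filter_upwards [hcont.eventually h1, hcont.eventually h2, self_mem_nhdsWithin] with q hq1 hq2 hq
      have hθ : |pTheta lo hi q| ≤ 1 := abs_pTheta_le hq
      have hval : pinchMap lo hi βlo βhi q - pinchMap lo hi βlo βhi p - ((fderiv ℝ βlo u).comp (initL m)) (q - p) =
          (βlo (Fin.init q) - βlo u - fderiv ℝ βlo u (Fin.init q - u)) + pTheta lo hi q * d (Fin.init q) := by
        have hp0 : pinchMap lo hi βlo βhi p = βlo u := by
          have : p = Fin.snoc u (lo u) := by rw [← hplast, hu, Fin.snoc_init_self]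
          rw [this]; exact pinchMap_bottom u
        rw [hp0]
        simp only [pinchMap, ContinuousLinearMap.comp_apply, initL_apply, hddef]
        have : Fin.init (q - p) = Fin.init q - u := by funext i; simp [Fin.init, hu]
        rw [this]; ring
      rw [hval]
      have hn : ‖Fin.init q - u‖ ≤ ‖q - p‖ := by
        have : Fin.init q - u = Fin.init (q - p) := by funext i; simp [Fin.init, hu]
        rw [this]; exact norm_init_le _
      simp only [sub_zero, zero_apply] at hq2
      rw [hdZ0 u huZ, sub_zero] at hq2
      calc ‖βlo (Fin.init q) - βlo u - (fderiv ℝ βlo u) (Fin.init q - u) + pTheta lo hi q * d (Fin.init q)‖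
          ≤ ‖βlo (Fin.init q) - βlo u - (fderiv ℝ βlo u) (Fin.init q - u)‖ + ‖pTheta lo hi q * d (Fin.init q)‖ := norm_add_le _ _
        _ ≤ ε / 2 * ‖Fin.init q - u‖ + 1 * (ε / 2 * ‖Fin.init q - u‖) := by
            refine add_le_add hq1 ?_
            rw [norm_mul]
            exact mul_le_mul ((Real.norm_eq_abs _).le.trans hθ) hq2 (norm_nonneg _) zero_le_one
        _ = ε * ‖Fin.init q - u‖ := by ring
        _ ≤ ε * ‖q - p‖ := mul_le_mul_of_nonneg_left hn hε.le

end Pinch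

end Literature.ModelTheory.ExponentialFields
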